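import Literature.AlgebraicGeometry.Motives.GrassmannianZariskiSheaf
import Literature.AlgebraicGeometry.Motives.GrassmannianMapLocalization
import HarnessLib

/-!
# The Grassmannian functor glues along finite standard Zariski covers of `Spec A`

Topic `AlgebraicGeometry/Motives`; namespace `Literature.AlgebraicGeometry.Motives.Grassmannian`.
THEOREMS ONLY (no definition, no named fact, no instance, no `sorry`).

[GortzWedhorn2020, (8.4) pp. 213–215 and (8.6) p. 217]: the Grassmannian functor `Grass_{k}(M)` (quotients locally free of rank `k`;
Mathlib `Module.Grassmannian.functor R M k`, acting on algebra maps by `Module.Grassmannian.map` = `u ⊗ id`) is a sheaf for the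
Zariski topology.  This file proves the AFFINE GLUING STATEMENT behind it, for Mathlib's functor verbatim: let `A` be an
`R`-algebra, `s ⊆ A` a finite set generating the unit ideal, `Bᵢ = A[1/i]` (`i ∈ s`, any `IsLocalization.Away` model) and
`Bᵢ → Bᵢⱼ ← Bⱼ` `A`-algebra maps exhibiting `Bᵢⱼ` as `Bᵢ[1/j]` and as `Bⱼ[1/i]`; then Grassmannian elements
`Nᵢ ∈ G(k, Bᵢ ⊗[R] M; Bᵢ)` that AGREE in `G(k, Bᵢⱼ ⊗[R] M; Bᵢⱼ)` come from EXACTLY ONE `N ∈ G(k, A ⊗[R] M; A)`.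
Assembly of ★ `GrassmannianZariskiSheaf` (gluing of submodules with finite projective constant-rank quotients, in Mathlib's
`IsLocalizedModule` currency) through ★ `GrassmannianMapLocalization` (`map` along a localization = `Submodule.localized'`).

* §1 (private) `restrictScalars_localized'_eq_localized₀` — a `Bᵢ`-level `localized'` at the powers of `algebraMap j` is, after restricting
  scalars to `A`, the `A`-level `localized₀` at the powers of `j` (same fractions);
  `rTensor_comp_rTensor_algebraMap` — `(ψ ⊗ 1) ∘ (ιᵢ ⊗ 1) = (ιᵢⱼ ⊗ 1)` for an `A`-algebra map `ψ : Bᵢ → Bᵢⱼ`;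
* §2 **`existsUnique_map_eq_of_map_eq`** — the gluing statement above.

Cell `hodgecm-mathlib` (D-0151), F-DAG first hand (h4) «Grassmannian as a scheme» (B-p21 (g15) author; B-p18 (g17) charts,
B-p09 (g12) openness), count-neutral Mathlib-side capital (brick (Z-gr)).  Nothing here is about HC; HC_CM is proved only modulo the
7 printed citations until rung 0 closes.

## References
* [GortzWedhorn2020] U. Görtz, T. Wedhorn, *Algebraic Geometry I*, 2nd ed. (2020), (8.4) (pp. 213–215) and (8.6) (p. 217); Thm. 7.12
  (p. 185) with Cor. 7.17 (p. 188).
* [StacksProject] The Stacks project, Tag 089R (Grassmannians) and Tag 00EO.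
-/

namespace Literature.AlgebraicGeometry.Motives.Grassmannian

open TensorProduct IsLocalizedModule

universe u v w

/-! ## §1 Plumbing -/

section Plumbing

variable {A : Type*} [CommRing A] {B : Type*} [CommRing B] [Algebra A B]
  {C : Type*} [CommRing C] [Algebra B C] [Algebra A C]
  {P : Type*} [AddCommGroup P] [Module A P] [Module B P] [IsScalarTower A B P]
  {Q : Type*} [AddCommGroup Q] [Module A Q] [Module B Q] [IsScalarTower A B Q] [Module C Q] [IsScalarTower B C Q]
  [IsScalarTower A C Q]

/-- **Same fractions**: for a `B`-linear `f : P → Q` that is a localization at the powers of `algebraMap A B a`, and a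
`B`-submodule `N ≤ P`, the `C`-submodule `N.localized'` (base ring `B`, denominators `(algebraMap a)ⁿ`) restricted to `A` is the
`A`-submodule `localized₀` of `N` for `f` restricted to `A` (denominators `aⁿ`). [folklore] -/
private theorem restrictScalars_localized'_eq_localized₀ (a : A) (f : P →ₗ[B] Q)
    [IsLocalization (.powers (algebraMap A B a)) C] [IsLocalizedModule (.powers (algebraMap A B a)) f]
    [IsLocalizedModule (.powers a) (f.restrictScalars A)] (N : Submodule B P) :
    (N.localized' C (.powers (algebraMap A B a)) f).restrictScalars A =
      (N.restrictScalars A).localized₀ (.powers a) (f.restrictScalars A) := by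
  ext x
  simp only [Submodule.restrictScalars_mem, Submodule.mem_localized₀]
  change (∃ m ∈ N, ∃ t : Submonoid.powers (algebraMap A B a), IsLocalizedModule.mk' f m t = x) ↔ _
  constructor
  · rintro ⟨m, hm, t, hx⟩
    obtain ⟨n, hn⟩ := (Submonoid.mem_powers_iff _ _).1 t.2
    refine ⟨m, hm, ⟨a ^ n, n, rfl⟩, ?_⟩
    rw [IsLocalizedModule.mk'_eq_iff, Submonoid.smul_def] at hx ⊢
    rw [← hn] at hx
    change f m = (a ^ n) • x
    rw [hx, ← map_pow, algebraMap_smul]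
  · rintro ⟨m, hm, t, hx⟩
    obtain ⟨n, hn⟩ := (Submonoid.mem_powers_iff _ _).1 t.2
    refine ⟨m, hm, ⟨algebraMap A B a ^ n, n, rfl⟩, ?_⟩
    rw [IsLocalizedModule.mk'_eq_iff, Submonoid.smul_def] at hx ⊢
    rw [← hn] at hx
    change f m = (algebraMap A B a ^ n) • x
    rw [LinearMap.restrictScalars_apply] at hx
    rw [hx, ← map_pow, algebraMap_smul]

end Plumbing

section Overlap

-- `Module.Grassmannian.map` asks all algebras to live in one universe (Mathlib), hence `A B' C : Type w`.
variable {R : Type u} [CommRing R] {M : Type v} [AddCommGroup M] [Module R M] {k : ℕ}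
  {A B' C : Type w} [CommRing A] [Algebra R A] [CommRing B'] [Algebra R B'] [Algebra A B'] [IsScalarTower R A B']
  [CommRing C] [Algebra R C] [Algebra A C] [IsScalarTower R A C]

/-- `(ψ ⊗ 1) ∘ (ι_{B′} ⊗ 1) = ι_C ⊗ 1` on `A ⊗[R] M` for an `A`-algebra map `ψ : B′ → C` (`ι` the structure maps). [folklore] -/
private theorem rTensor_comp_rTensor_algebraMap (ψ : B' →ₐ[A] C) :
    (AlgebraTensorModule.rTensor R M ψ.toLinearMap) ∘ₗ (AlgebraTensorModule.rTensor R M (Algebra.linearMap A B')) =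
      AlgebraTensorModule.rTensor R M (Algebra.linearMap A C) := by
  apply TensorProduct.AlgebraTensorModule.ext
  intro a m
  simp [AlgebraTensorModule.rTensor_tmul, Algebra.linearMap_apply, AlgHom.commutes]

/-- **`ψ ⊗ 1` is a localization away from `a`** when the `A`-algebra map `ψ : B′ → C` exhibits `C` as `B′[1/a]` (the `B′`-linear
base change `ι ⊗ 1 : B′ ⊗ M → C ⊗ M` is a localization by Mathlib `IsLocalizedModule.rTensor`; restrict scalars to `A`).
[cite: GortzWedhorn2020, Thm. 7.12 (p. 185) with Cor. 7.17 (p. 188)] -/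
theorem isLocalizedModule_rTensor_of_isLocalization (ψ : B' →ₐ[A] C) (a : A)
    (hψ : @IsLocalization _ _ (.powers (algebraMap A B' a)) C _ ψ.toRingHom.toAlgebra) :
    IsLocalizedModule (.powers a) (AlgebraTensorModule.rTensor R M ψ.toLinearMap) := by
  letI : Algebra B' C := ψ.toRingHom.toAlgebra
  haveI : IsScalarTower A B' C := IsScalarTower.of_algebraMap_eq fun x => (ψ.commutes x).symm
  haveI : IsScalarTower R B' C := IsScalarTower.of_algebraMap_eq fun x => by
    rw [IsScalarTower.algebraMap_apply R A B', IsScalarTower.algebraMap_apply R A C]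
    exact (ψ.commutes _).symm
  let f : B' ⊗[R] M →ₗ[B'] C ⊗[R] M := AlgebraTensorModule.rTensor R M (Algebra.linearMap B' C)
  have hfψ : f.restrictScalars A = AlgebraTensorModule.rTensor R M ψ.toLinearMap := by
    apply LinearMap.ext
    intro x
    induction x using TensorProduct.induction_on with
    | zero => simp
    | tmul b m => rfl
    | add x y hx hy => simp only [map_add, hx, hy]
  rw [← hfψ]
  exact IsLocalizedModule.restrictScalars_powers a f

/-- **`map ψ` read in `A`-fractions**: for `ψ : B′ → C = B′[1/a]` as above and `N ∈ G(k, B′ ⊗[R] M; B′)`, the `C`-submodule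
`(map ψ N)` restricted to `A` is the `A`-level `localized₀` of `N` away from `a` for `ψ ⊗ 1` (★ `map_toSubmodule_eq_localized'`
over `B′`, then the same fractions with denominators `aⁿ` instead of `(ι a)ⁿ`). [cite: GortzWedhorn2020, (8.4) (pp. 213–215) and (8.6) (p. 217)] -/
theorem restrictScalars_map_toSubmodule_eq_localized₀ (ψ : B' →ₐ[A] C) (a : A)
    (_hψ : @IsLocalization _ _ (.powers (algebraMap A B' a)) C _ ψ.toRingHom.toAlgebra)
    [IsLocalizedModule (.powers a) (AlgebraTensorModule.rTensor R M ψ.toLinearMap)]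
    (N : Module.Grassmannian B' (B' ⊗[R] M) k) :
    (Module.Grassmannian.map (ψ.restrictScalars R) N).toSubmodule.restrictScalars A =
      (N.toSubmodule.restrictScalars A).localized₀ (.powers a) (AlgebraTensorModule.rTensor R M ψ.toLinearMap) := by
  letI : Algebra B' C := ψ.toRingHom.toAlgebra
  haveI : IsScalarTower A B' C := IsScalarTower.of_algebraMap_eq fun x => (ψ.commutes x).symm
  haveI : IsScalarTower R B' C := IsScalarTower.of_algebraMap_eq fun x => by
    rw [IsScalarTower.algebraMap_apply R A B', IsScalarTower.algebraMap_apply R A C]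
    exact (ψ.commutes _).symm
  haveI : IsScalarTower B' C (C ⊗[R] M) := TensorProduct.isScalarTower_left
  let f : B' ⊗[R] M →ₗ[B'] C ⊗[R] M := AlgebraTensorModule.rTensor R M (Algebra.linearMap B' C)
  haveI hf : IsLocalizedModule (.powers (algebraMap A B' a)) f := inferInstance
  have hfψ : f.restrictScalars A = AlgebraTensorModule.rTensor R M ψ.toLinearMap := by
    apply LinearMap.ext
    intro x
    induction x using TensorProduct.induction_on with
    | zero => simp
    | tmul b m => rfl
    | add x y hx hy => simp only [map_add, hx, hy]
  haveI : IsLocalizedModule (.powers a) (f.restrictScalars A) := by rw [hfψ]; infer_instance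
  have hψ' : ψ.restrictScalars R = IsScalarTower.toAlgHom R B' C := AlgHom.ext fun _ => rfl
  rw [hψ', map_toSubmodule_eq_localized' (R := R) (M := M) (.powers (algebraMap A B' a)) N,
    restrictScalars_localized'_eq_localized₀ a f N.toSubmodule]
  -- same map, two spellings (the `IsLocalizedModule` instance is a `Prop`)
  have key : ∀ (f' : B' ⊗[R] M →ₗ[A] C ⊗[R] M) (_ : IsLocalizedModule (.powers a) f'),
      f' = AlgebraTensorModule.rTensor R M ψ.toLinearMap →
      (N.toSubmodule.restrictScalars A).localized₀ (.powers a) f' =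
        (N.toSubmodule.restrictScalars A).localized₀ (.powers a) (AlgebraTensorModule.rTensor R M ψ.toLinearMap) := by
    rintro _ _ rfl
    rfl
  exact key _ _ hfψ

end Overlap

/-! ## §2 Gluing Grassmannian elements -/

section Gluing

-- `Module.Grassmannian.map` asks all algebras to live in one universe (Mathlib), hence `A`, `B i`, `B₂ i j : Type w`.
variable {R : Type u} [CommRing R] {M : Type v} [AddCommGroup M] [Module R M] {k : ℕ}
  {A : Type w} [CommRing A] [Algebra R A]
  (s : Set A) [Finite s] (hs : Ideal.span s = ⊤)
  (B : s → Type w) [∀ i, CommRing (B i)] [∀ i, Algebra R (B i)] [∀ i, Algebra A (B i)] [∀ i, IsScalarTower R A (B i)]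
  [∀ i : s, IsLocalization.Away (i : A) (B i)]
  (B₂ : s → s → Type w) [∀ i j, CommRing (B₂ i j)] [∀ i j, Algebra R (B₂ i j)] [∀ i j, Algebra A (B₂ i j)]
  [∀ i j, IsScalarTower R A (B₂ i j)]
  (ψl : ∀ i j : s, B i →ₐ[A] B₂ i j) (ψr : ∀ i j : s, B j →ₐ[A] B₂ i j)

include hs in
/-- **GLUING IN THE GRASSMANNIAN FUNCTOR along a finite standard cover of `Spec A`.**  Let `s ⊆ A` be finite with
`(s) = A`, `Bᵢ` a localization of `A` away from `i ∈ s`, and `ψl : Bᵢ → Bᵢⱼ`, `ψr : Bⱼ → Bᵢⱼ` `A`-algebra maps making `Bᵢⱼ`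
the localization of `Bᵢ` away from `j` and of `Bⱼ` away from `i` (hypotheses `hl`, `hr`, stated for the algebra structures
induced by `ψl`, `ψr`; e.g. `Bᵢⱼ = A[1/ij]`).  If `Nᵢ ∈ G(k, Bᵢ ⊗[R] M; Bᵢ)` satisfy `map ψl Nᵢ = map ψr Nⱼ` in
`G(k, Bᵢⱼ ⊗[R] M; Bᵢⱼ)` for all `i, j`, then there is EXACTLY ONE `N ∈ G(k, A ⊗[R] M; A)` with `map (A → Bᵢ) N = Nᵢ` for every `i`
— the sheaf condition of `Module.Grassmannian.functor R M k` for the cover `{D(i)}_{i ∈ s}` of `Spec A` ([GortzWedhorn2020, (8.6)]).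
Proof: ★ `map_toSubmodule_eq_localized'` turns every `map` into a `Submodule.localized'`; ★ `existsUnique_localized'_eq` glues the
submodules; ★ `finite_projective_rankAtStalk_quotient_of_localized'_eq` keeps the glued quotient finite projective of rank `k`.
[cite: GortzWedhorn2020, (8.4) (pp. 213–215) and (8.6) (p. 217)] [cite: StacksProject, Tag 089R] -/
theorem existsUnique_map_eq_of_map_eq
    (hl : ∀ i j : s, @IsLocalization _ _ (.powers (algebraMap A (B i) j)) (B₂ i j) _ (ψl i j).toRingHom.toAlgebra)
    (hr : ∀ i j : s, @IsLocalization _ _ (.powers (algebraMap A (B j) i)) (B₂ i j) _ (ψr i j).toRingHom.toAlgebra)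
    (N : ∀ i : s, Module.Grassmannian (B i) (B i ⊗[R] M) k)
    (hN : ∀ i j : s, Module.Grassmannian.map ((ψl i j).restrictScalars R) (N i) =
      Module.Grassmannian.map ((ψr i j).restrictScalars R) (N j)) :
    ∃! N₀ : Module.Grassmannian A (A ⊗[R] M) k,
      ∀ i : s, Module.Grassmannian.map (IsScalarTower.toAlgHom R A (B i)) N₀ = N i := by
  classical
  -- the localization maps `ιᵢ ⊗ 1 : A ⊗ M → Bᵢ ⊗ M`
  let g : ∀ i : s, A ⊗[R] M →ₗ[A] B i ⊗[R] M := fun i => AlgebraTensorModule.rTensor R M (Algebra.linearMap A (B i))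
  haveI hg : ∀ i : s, IsLocalizedModule (.powers (i : A)) (g i) := fun i => inferInstance
  -- the overlap maps `ψ ⊗ 1`, localizations away from `j` resp. `i` over `A`
  let l : ∀ i j : s, B i ⊗[R] M →ₗ[A] B₂ i j ⊗[R] M := fun i j => AlgebraTensorModule.rTensor R M (ψl i j).toLinearMap
  let r : ∀ i j : s, B j ⊗[R] M →ₗ[A] B₂ i j ⊗[R] M := fun i j => AlgebraTensorModule.rTensor R M (ψr i j).toLinearMap
  haveI hlI : ∀ i j : s, IsLocalizedModule (.powers (j : A)) (l i j) := fun i j =>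
    isLocalizedModule_rTensor_of_isLocalization (ψl i j) j (hl i j)
  haveI hrI : ∀ i j : s, IsLocalizedModule (.powers (i : A)) (r i j) := fun i j =>
    isLocalizedModule_rTensor_of_isLocalization (ψr i j) i (hr i j)
  have hlr : ∀ i j : s, l i j ∘ₗ g i = r i j ∘ₗ g j := fun i j => by
    change (AlgebraTensorModule.rTensor R M (ψl i j).toLinearMap) ∘ₗ _ = (AlgebraTensorModule.rTensor R M (ψr i j).toLinearMap) ∘ₗ _
    rw [rTensor_comp_rTensor_algebraMap, rTensor_comp_rTensor_algebraMap]
  -- compatibility of the submodules on the overlaps, in `A`-fractions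
  have hN' : ∀ i j : s, (((N i).toSubmodule).restrictScalars A).localized₀ (.powers (j : A)) (l i j) =
      (((N j).toSubmodule).restrictScalars A).localized₀ (.powers (i : A)) (r i j) := fun i j => by
    change _ = (((N j).toSubmodule).restrictScalars A).localized₀ (.powers (i : A))
      (AlgebraTensorModule.rTensor R M (ψr i j).toLinearMap)
    rw [← restrictScalars_map_toSubmodule_eq_localized₀ (ψr i j) i (hr i j) (N j), ← hN i j]
    exact (restrictScalars_map_toSubmodule_eq_localized₀ (ψl i j) j (hl i j) (N i)).symm
  -- glue the submodules
  obtain ⟨N₀, hN₀, huniq⟩ := existsUnique_localized'_eq s B (fun i => B i ⊗[R] M) g (fun i j => B₂ i j ⊗[R] M) l r hs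
    hlr (fun i => (N i).toSubmodule) hN'
  -- the glued quotient is finite projective of rank `k`
  obtain ⟨hfin, hproj, hrk⟩ := finite_projective_rankAtStalk_quotient_of_localized'_eq s B (fun i => B i ⊗[R] M) g hs
    (fun i => (N i).toSubmodule) N₀ hN₀ k (fun i => (N i).finite_quotient) (fun i => (N i).projective_quotient)
    (fun i => (N i).rankAtStalk_eq)
  refine ⟨⟨N₀, hfin, hproj, hrk⟩, fun i => ?_, fun N' hN'' => ?_⟩
  · apply Module.Grassmannian.ext
    rw [map_toSubmodule_eq_localized' (R := R) (M := M) (.powers (i : A))]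
    exact hN₀ i
  · apply Module.Grassmannian.ext
    change N'.toSubmodule = N₀
    refine huniq _ fun i => ?_
    rw [← map_toSubmodule_eq_localized' (R := R) (M := M) (.powers (i : A)) N', hN'' i]

end Gluing

end Literature.AlgebraicGeometry.Motives.Grassmannian
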